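import Summits.ValiantsHypothesis.ValiantsHypothesis.Theses.KPlusLogSqLaw
import Summits.ValiantsHypothesis.ValiantsHypothesis.Theorems.KPlusLogSqLawTropicalPermutationChanges
import Summits.ValiantsHypothesis.ValiantsHypothesis.Theorems.KPlusLogSqLawTropicalBRegimeCollapse

/-!
# Route «KPlusLogSqLaw», crux `TropicalB` (stmt-ValiantsHypothesis-19771) — the crux is a PERMUTATION BUDGET:
# `TropicalB` ⟺ «sign-alternating dominant chains change their permutation at most `2^(C (K + ⌊log₂ m⌋²))` times»
# ⟺ «… use at most `2^(C (K + ⌊log₂ m⌋²))` distinct permutations» ⟺ the same on the diagonal formats `(2^s, s²)`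

HONEST FRAMING.  Helper file toward the registered stub `stub_tropFat` (⟺ `TropicalB`, `fatStub_iff_tropicalB` of
`…TropicalBRegimeCollapse`) of `Cruxes/TropicalB/Lines/birth.lean` (crux
`Summit.ValiantsHypothesis.ValiantsHypothesis.Theses.KPlusLogSqLaw.TropicalB`, ledger item `stmt-ValiantsHypothesis-19771`,
route `KPlusLogSqLaw`; cell `pub-symmetroid`, seat val-sym-trop-p2 (g2), 2026-08-26).  Every theorem here is an EQUIVALENCE
between statements that are OPEN, obtained from two landed structure lemmas; nothing is asserted about `TropicalB`,
`WeakLifting`, `KPlusLogSqLaw`, `MatrixDescartes` (stmt-ValiantsHypothesis-18050) or VP ≠ VNP.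

Write `L = ⌊log₂ m⌋`, and for a dominant sign-alternating chain `p₀, …, pₙ` (`pₖ = (σₖ, λₖ)`, hypothesis list of
`TropRootLawAt`) let `P = #{k < n : σₖ ≠ σₖ₊₁}` (permutation-changing steps) and `F = #{σₖ : k ≤ n}` (distinct permutations).
The tree has (val-sym-lift-p2, `…TropicalPermutationChanges`): `n ≤ P + m²(K−1)` (`le_permChanges_add`: class switches at a
fixed permutation are an ADDITIVE `O(m²K)`) and `n + 1 ≤ F·(m(K−1)+1)` (`succ_le_card_perms_mul`).  Since
`m²(K−1) ≤ 2^(4(K+L²))` and `m(K−1)+1 ≤ 2^(2(K+L²))`, the crux is equivalent to a budget on permutation dynamics alone: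

* `tropicalB_iff_permSteps`  — `TropicalB ↔ ∃ C, ∀ chains, P ≤ 2^(C (K + L²))`;
* `tropicalB_iff_cardPerms`  — `TropicalB ↔ ∃ C, ∀ chains, F ≤ 2^(C (K + L²))`;
* `tropicalB_iff_permSteps_diagonal` — `TropicalB ↔ ∃ C, ∀ s, ∀ chains of format (2^s, s²), P ≤ 2^(C·s²)`
  (with `tropicalB_iff_diagonal` of `…TropicalBRegimeCollapse`).

READING (located, not claimed).  A counterexample to `TropicalB` must change its optimal PERMUTATION super-quasi-polynomially
often (class flips never matter: all of them together are `≤ m²(K−1)`); dually an in-window proof of `TropicalB` is exactly a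
bound on the number of distinct optimal assignments of a `K`-slope-class parametric assignment problem along a line.  In the
cell's families: SHIFT-THREE changes permutation `m − 1` times (its `Θ(m²)` is flips), the staircase `n^{K−2}` times on
`4^K n²` rows; no family with more than `O(m)` permutation changes per `O(1)` classes on `m` rows is known
(HOME/val-sym-trop-p2/g2/REGISTERS-g2.md R8–R11).  [folklore] bookkeeping over the two cited tree lemmas.
-/

set_option linter.dupNamespace false
set_option autoImplicit false

namespace Summit.ValiantsHypothesis.ValiantsHypothesis.Theorems.KPlusLogSqLaw

open Summit.ValiantsHypothesis.ValiantsHypothesis.Theorems.LacunarySymmetroidMatrixDescartes.TropicalCensus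
open Summit.ValiantsHypothesis.ValiantsHypothesis.Theorems.MatrixDescartes.Negative
open Summit.ValiantsHypothesis.ValiantsHypothesis.Theses.KPlusLogSqLaw (TropicalB)
open Finset

/-! ## 0. Arithmetic: the additive budgets are inside `2^(O(K + L²))` -/

/-- The class-switch budget is quasi-polynomially small: `m·m·(K−1) ≤ 2^(4(K + L²))`. [folklore] -/
theorem sq_mul_pred_le_two_pow (m K : ℕ) : m * m * (K - 1) ≤ 2 ^ (4 * (K + Nat.log 2 m ^ 2)) := by
  rcases Nat.eq_zero_or_pos K with rfl | hK0
  · simp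
  have hm : m ≤ 2 ^ (Nat.log 2 m + 1) := (Nat.lt_pow_succ_log_self one_lt_two m).le
  have hK : K - 1 ≤ 2 ^ K := (Nat.sub_le K 1).trans Nat.lt_two_pow_self.le
  have hL : Nat.log 2 m ≤ Nat.log 2 m ^ 2 := Nat.le_self_pow two_ne_zero _
  have h1 : m * m * (K - 1) ≤ 2 ^ (Nat.log 2 m + 1) * 2 ^ (Nat.log 2 m + 1) * 2 ^ K :=
    Nat.mul_le_mul (Nat.mul_le_mul hm hm) hK
  have h2 : 2 ^ (Nat.log 2 m + 1) * 2 ^ (Nat.log 2 m + 1) * 2 ^ K = 2 ^ (2 * Nat.log 2 m + K + 2) := by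
    rw [← pow_add, ← pow_add]; congr 1; ring
  rw [h2] at h1
  exact h1.trans (Nat.pow_le_pow_right two_pos (by nlinarith))

/-- The permutation-fibre factor is quasi-polynomially small: `m·(K−1) + 1 ≤ 2^(2(K + L²))`. [folklore] -/
theorem mul_pred_succ_le_two_pow (m K : ℕ) : m * (K - 1) + 1 ≤ 2 ^ (2 * (K + Nat.log 2 m ^ 2)) := by
  rcases Nat.eq_zero_or_pos K with rfl | hKpos
  · simp [Nat.one_le_two_pow]
  have hm : m < 2 ^ (Nat.log 2 m + 1) := Nat.lt_pow_succ_log_self one_lt_two m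
  have hK : K - 1 ≤ 2 ^ (K - 1) := Nat.lt_two_pow_self.le
  have hL : Nat.log 2 m ≤ Nat.log 2 m ^ 2 := Nat.le_self_pow two_ne_zero _
  have hB : 1 ≤ 2 ^ (K - 1) := Nat.one_le_two_pow
  have h1 : m * (K - 1) + 1 ≤ 2 ^ (Nat.log 2 m + 1) * 2 ^ (K - 1) := by
    have hm' : m + 1 ≤ 2 ^ (Nat.log 2 m + 1) := hm
    calc m * (K - 1) + 1 ≤ m * 2 ^ (K - 1) + 2 ^ (K - 1) := Nat.add_le_add (Nat.mul_le_mul_left m hK) hB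
      _ = (m + 1) * 2 ^ (K - 1) := by ring
      _ ≤ 2 ^ (Nat.log 2 m + 1) * 2 ^ (K - 1) := Nat.mul_le_mul_right _ hm'
  have h2 : 2 ^ (Nat.log 2 m + 1) * 2 ^ (K - 1) = 2 ^ (Nat.log 2 m + K) := by
    rw [← pow_add]; congr 1; omega
  rw [h2] at h1
  exact h1.trans (Nat.pow_le_pow_right two_pos (by nlinarith))

/-- Sum of two quasi-polynomial budgets: `2^(C X) + 2^(4 X) ≤ 2^((C+5) X)` for `X ≥ 1`. [folklore] -/
theorem two_pow_add_two_pow_le (C X : ℕ) (hX : 1 ≤ X) : 2 ^ (C * X) + 2 ^ (4 * X) ≤ 2 ^ ((C + 5) * X) := by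
  have h1 : 2 ^ (C * X) ≤ 2 ^ ((C + 4) * X) := Nat.pow_le_pow_right two_pos (by nlinarith)
  have h2 : 2 ^ (4 * X) ≤ 2 ^ ((C + 4) * X) := Nat.pow_le_pow_right two_pos (by nlinarith)
  calc 2 ^ (C * X) + 2 ^ (4 * X) ≤ 2 ^ ((C + 4) * X) + 2 ^ ((C + 4) * X) := Nat.add_le_add h1 h2
    _ = 2 ^ ((C + 4) * X + 1) := by rw [pow_succ]; ring
    _ ≤ 2 ^ ((C + 5) * X) := Nat.pow_le_pow_right two_pos (by nlinarith)

/-! ## 1. Permutation-changing steps -/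

/-- **Permutation-step budget ⇒ TB.**  If every sign-alternating dominant chain of every format `(m, K)` changes its
permutation at most `2^(C (K + L²))` times, then `TropicalB` holds (with `C + 5`): the remaining steps are class switches at a
fixed permutation, at most `m²(K−1) ≤ 2^(4(K+L²))` of them (`le_permChanges_add`). -/
theorem tropicalB_of_permSteps
    (h : ∃ C : ℕ, ∀ (m K : ℕ) (d : Fin K → ℕ) (v ε : Fin m → Fin m → Fin K → ℤ) (n : ℕ) (θ : Fin (n + 1) → ℤ)
      (p : Fin (n + 1) → Equiv.Perm (Fin m) × (Fin m → Fin K)),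
      (∀ i j l, (ε i j l).natAbs ≤ 1) → StrictMono θ → (∀ k, IsDominant d v ε (θ k) (p k)) →
      (∀ k : Fin n, termSign ε (p k.castSucc) * termSign ε (p k.succ) < 0) →
      (univ.filter fun k : Fin n => (p k.castSucc).1 ≠ (p k.succ).1).card ≤ 2 ^ (C * (K + Nat.log 2 m ^ 2))) :
    TropicalB := by
  classical
  obtain ⟨C, hC⟩ := h
  refine ⟨C + 5, fun m K => ?_⟩
  show TropRootLawAt m K (2 ^ ((C + 5) * (K + Nat.log 2 m ^ 2)))
  rcases Nat.eq_zero_or_pos K with rfl | hKpos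
  · exact tropRootLawAt_zero m _
  intro d v ε n θ p hε hθ hdom halt
  have h1 := le_permChanges_add d v ε n θ p hθ hdom halt
  have h2 := hC m K d v ε n θ p hε hθ hdom halt
  have h3 := sq_mul_pred_le_two_pow m K
  have hX : 1 ≤ K + Nat.log 2 m ^ 2 := by omega
  have h4 := two_pow_add_two_pow_le C (K + Nat.log 2 m ^ 2) hX
  omega

/-- **TB ⇒ permutation-step budget** (with the same constant): the permutation-changing steps are a subset of all steps. -/
theorem permSteps_of_tropicalB (h : TropicalB) :
    ∃ C : ℕ, ∀ (m K : ℕ) (d : Fin K → ℕ) (v ε : Fin m → Fin m → Fin K → ℤ) (n : ℕ) (θ : Fin (n + 1) → ℤ)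
      (p : Fin (n + 1) → Equiv.Perm (Fin m) × (Fin m → Fin K)),
      (∀ i j l, (ε i j l).natAbs ≤ 1) → StrictMono θ → (∀ k, IsDominant d v ε (θ k) (p k)) →
      (∀ k : Fin n, termSign ε (p k.castSucc) * termSign ε (p k.succ) < 0) →
      (univ.filter fun k : Fin n => (p k.castSucc).1 ≠ (p k.succ).1).card ≤ 2 ^ (C * (K + Nat.log 2 m ^ 2)) := by
  classical
  obtain ⟨C, hC⟩ := h
  refine ⟨C, fun m K d v ε n θ p hε hθ hdom halt => ?_⟩
  have h1 : n ≤ 2 ^ (C * (K + Nat.log 2 m ^ 2)) := hC m K d v ε n θ p hε hθ hdom halt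
  calc (univ.filter fun k : Fin n => (p k.castSucc).1 ≠ (p k.succ).1).card ≤ (univ : Finset (Fin n)).card :=
        card_filter_le _ _
    _ = n := by rw [card_univ, Fintype.card_fin]
    _ ≤ 2 ^ (C * (K + Nat.log 2 m ^ 2)) := h1

/-- **`TropicalB` ⟺ the permutation-step budget.**  The crux is equivalent to: there is an absolute `C` such that every
sign-alternating dominant chain of every dominance design of format `(m, K)` changes its PERMUTATION at most
`2^(C (K + ⌊log₂ m⌋²))` times.  Class flips at a fixed permutation never decide the crux. -/
theorem tropicalB_iff_permSteps :
    TropicalB ↔ ∃ C : ℕ, ∀ (m K : ℕ) (d : Fin K → ℕ) (v ε : Fin m → Fin m → Fin K → ℤ) (n : ℕ) (θ : Fin (n + 1) → ℤ)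
      (p : Fin (n + 1) → Equiv.Perm (Fin m) × (Fin m → Fin K)),
      (∀ i j l, (ε i j l).natAbs ≤ 1) → StrictMono θ → (∀ k, IsDominant d v ε (θ k) (p k)) →
      (∀ k : Fin n, termSign ε (p k.castSucc) * termSign ε (p k.succ) < 0) →
      (univ.filter fun k : Fin n => (p k.castSucc).1 ≠ (p k.succ).1).card ≤ 2 ^ (C * (K + Nat.log 2 m ^ 2)) :=
  ⟨permSteps_of_tropicalB, tropicalB_of_permSteps⟩

/-! ## 2. Distinct permutations -/

/-- **Distinct-permutation budget ⇒ TB.**  If every sign-alternating dominant chain of format `(m, K)` uses at most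
`2^(C (K + L²))` distinct permutations, then `TropicalB` holds (with `C + 2`): each permutation carries at most
`m(K−1) + 1 ≤ 2^(2(K+L²))` chain terms (`succ_le_card_perms_mul`). -/
theorem tropicalB_of_cardPerms
    (h : ∃ C : ℕ, ∀ (m K : ℕ) (d : Fin K → ℕ) (v ε : Fin m → Fin m → Fin K → ℤ) (n : ℕ) (θ : Fin (n + 1) → ℤ)
      (p : Fin (n + 1) → Equiv.Perm (Fin m) × (Fin m → Fin K)),
      (∀ i j l, (ε i j l).natAbs ≤ 1) → StrictMono θ → (∀ k, IsDominant d v ε (θ k) (p k)) →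
      (∀ k : Fin n, termSign ε (p k.castSucc) * termSign ε (p k.succ) < 0) →
      (univ.image fun k => (p k).1).card ≤ 2 ^ (C * (K + Nat.log 2 m ^ 2))) :
    TropicalB := by
  classical
  obtain ⟨C, hC⟩ := h
  refine ⟨C + 2, fun m K => ?_⟩
  show TropRootLawAt m K (2 ^ ((C + 2) * (K + Nat.log 2 m ^ 2)))
  intro d v ε n θ p hε hθ hdom halt
  have h1 := succ_le_card_perms_mul d v ε n θ p hθ hdom halt
  have h2 := hC m K d v ε n θ p hε hθ hdom halt
  have h3 := mul_pred_succ_le_two_pow m K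
  have h4 : n + 1 ≤ 2 ^ (C * (K + Nat.log 2 m ^ 2)) * 2 ^ (2 * (K + Nat.log 2 m ^ 2)) :=
    h1.trans (Nat.mul_le_mul h2 h3)
  rw [← pow_add] at h4
  have h5 : C * (K + Nat.log 2 m ^ 2) + 2 * (K + Nat.log 2 m ^ 2) = (C + 2) * (K + Nat.log 2 m ^ 2) := by ring
  rw [h5] at h4
  omega

/-- **TB ⇒ distinct-permutation budget** (with `C + 1`): a chain of `n + 1` terms uses at most `n + 1` permutations, and
`n + 1 ≤ 2^(C X) + 1 ≤ 2^((C+1) X)` unless `X = K + L² = 0`, where `m ≤ 1` and there is only one permutation at all. -/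
theorem cardPerms_of_tropicalB (h : TropicalB) :
    ∃ C : ℕ, ∀ (m K : ℕ) (d : Fin K → ℕ) (v ε : Fin m → Fin m → Fin K → ℤ) (n : ℕ) (θ : Fin (n + 1) → ℤ)
      (p : Fin (n + 1) → Equiv.Perm (Fin m) × (Fin m → Fin K)),
      (∀ i j l, (ε i j l).natAbs ≤ 1) → StrictMono θ → (∀ k, IsDominant d v ε (θ k) (p k)) →
      (∀ k : Fin n, termSign ε (p k.castSucc) * termSign ε (p k.succ) < 0) →
      (univ.image fun k => (p k).1).card ≤ 2 ^ (C * (K + Nat.log 2 m ^ 2)) := by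
  classical
  obtain ⟨C, hC⟩ := h
  refine ⟨C + 1, fun m K d v ε n θ p hε hθ hdom halt => ?_⟩
  have h1 : n ≤ 2 ^ (C * (K + Nat.log 2 m ^ 2)) := hC m K d v ε n θ p hε hθ hdom halt
  rcases Nat.eq_zero_or_pos (K + Nat.log 2 m ^ 2) with hX | hX
  · -- `K = 0` and `m ≤ 1`: the permutation group of `Fin m` is trivial
    have hL2 : Nat.log 2 m ^ 2 = 0 := by omega
    have hL : Nat.log 2 m = 0 := by
      rcases Nat.eq_zero_or_pos (Nat.log 2 m) with h0 | h0
      · exact h0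
      · have : 1 ≤ Nat.log 2 m ^ 2 := Nat.one_le_pow _ _ h0
        omega
    have hm : m ≤ 1 := by
      by_contra hm'
      have : 1 ≤ Nat.log 2 m := Nat.le_log_of_pow_le one_lt_two (by omega)
      omega
    have hcard : Fintype.card (Equiv.Perm (Fin m)) = 1 := by
      rw [Fintype.card_perm, Fintype.card_fin]
      interval_cases m <;> simp [Nat.factorial]
    calc (univ.image fun k => (p k).1).card ≤ (univ : Finset (Equiv.Perm (Fin m))).card := card_le_univ _
      _ = 1 := by rw [card_univ, hcard]
      _ ≤ 2 ^ ((C + 1) * (K + Nat.log 2 m ^ 2)) := Nat.one_le_two_pow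
  · calc (univ.image fun k => (p k).1).card ≤ (univ : Finset (Fin (n + 1))).card := card_image_le
      _ = n + 1 := by rw [card_univ, Fintype.card_fin]
      _ ≤ 2 ^ (C * (K + Nat.log 2 m ^ 2)) + 2 ^ (C * (K + Nat.log 2 m ^ 2)) :=
          Nat.add_le_add h1 Nat.one_le_two_pow
      _ = 2 ^ (C * (K + Nat.log 2 m ^ 2) + 1) := by rw [pow_succ]; ring
      _ ≤ 2 ^ ((C + 1) * (K + Nat.log 2 m ^ 2)) := Nat.pow_le_pow_right two_pos (by nlinarith)

/-- **`TropicalB` ⟺ the distinct-permutation budget.**  The crux is equivalent to: there is an absolute `C` such that every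
sign-alternating dominant chain of every dominance design of format `(m, K)` uses at most `2^(C (K + ⌊log₂ m⌋²))` distinct
permutations — a statement about the number of distinct optimal assignments of a `K`-slope-class parametric assignment
problem met along an increasing parameter, and about nothing else. -/
theorem tropicalB_iff_cardPerms :
    TropicalB ↔ ∃ C : ℕ, ∀ (m K : ℕ) (d : Fin K → ℕ) (v ε : Fin m → Fin m → Fin K → ℤ) (n : ℕ) (θ : Fin (n + 1) → ℤ)
      (p : Fin (n + 1) → Equiv.Perm (Fin m) × (Fin m → Fin K)),
      (∀ i j l, (ε i j l).natAbs ≤ 1) → StrictMono θ → (∀ k, IsDominant d v ε (θ k) (p k)) →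
      (∀ k : Fin n, termSign ε (p k.castSucc) * termSign ε (p k.succ) < 0) →
      (univ.image fun k => (p k).1).card ≤ 2 ^ (C * (K + Nat.log 2 m ^ 2)) :=
  ⟨cardPerms_of_tropicalB, tropicalB_of_cardPerms⟩

/-! ## 3. On the diagonal `(2^s, s²)` -/

/-- **Permutation-step budget on the diagonal ⇒ TB.**  If for every `s` the sign-alternating dominant chains of format
`(2^s, s²)` change permutation at most `2^(C·s²)` times, then `TropicalB` holds: on that format the class switches are
`m²(K−1) < 2^(8 s²)` (crudely), so `T(2^s, s²) ≤ 2^((C+9) s²)`, and `tropicalB_iff_diagonal` concludes. -/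
theorem tropicalB_of_permSteps_diagonal
    (h : ∃ C : ℕ, ∀ (s : ℕ) (d : Fin (s ^ 2) → ℕ) (v ε : Fin (2 ^ s) → Fin (2 ^ s) → Fin (s ^ 2) → ℤ) (n : ℕ)
      (θ : Fin (n + 1) → ℤ) (p : Fin (n + 1) → Equiv.Perm (Fin (2 ^ s)) × (Fin (2 ^ s) → Fin (s ^ 2))),
      (∀ i j l, (ε i j l).natAbs ≤ 1) → StrictMono θ → (∀ k, IsDominant d v ε (θ k) (p k)) →
      (∀ k : Fin n, termSign ε (p k.castSucc) * termSign ε (p k.succ) < 0) →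
      (univ.filter fun k : Fin n => (p k.castSucc).1 ≠ (p k.succ).1).card ≤ 2 ^ (C * s ^ 2)) :
    TropicalB := by
  classical
  obtain ⟨C, hC⟩ := h
  refine tropicalB_iff_diagonal.mpr ⟨C + 9, fun s => ?_⟩
  rcases Nat.eq_zero_or_pos s with rfl | hspos
  · exact tropRootLawAt_zero _ _
  intro d v ε n θ p hε hθ hdom halt
  have h1 := le_permChanges_add d v ε n θ p hθ hdom halt
  have h2 := hC s d v ε n θ p hε hθ hdom halt
  have h3 := sq_mul_pred_le_two_pow (2 ^ s) (s ^ 2)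
  rw [log_two_pow] at h3
  have hs1 : 1 ≤ s ^ 2 := Nat.one_le_pow _ _ hspos
  have h4 : 2 ^ (4 * (s ^ 2 + s ^ 2)) ≤ 2 ^ ((C + 8) * s ^ 2) := Nat.pow_le_pow_right two_pos (by nlinarith)
  have ha : 2 ^ (C * s ^ 2) ≤ 2 ^ ((C + 8) * s ^ 2) := Nat.pow_le_pow_right two_pos (by nlinarith)
  have h5 : 2 ^ ((C + 8) * s ^ 2) + 2 ^ ((C + 8) * s ^ 2) ≤ 2 ^ ((C + 9) * s ^ 2) := by
    calc 2 ^ ((C + 8) * s ^ 2) + 2 ^ ((C + 8) * s ^ 2) = 2 ^ ((C + 8) * s ^ 2 + 1) := by rw [pow_succ]; ring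
      _ ≤ 2 ^ ((C + 9) * s ^ 2) := Nat.pow_le_pow_right two_pos (by nlinarith)
  omega

/-- **TB ⇒ permutation-step budget on the diagonal** (constant `2C`: `K + ⌊log₂ 2^s⌋² = 2 s²`). -/
theorem permSteps_diagonal_of_tropicalB (h : TropicalB) :
    ∃ C : ℕ, ∀ (s : ℕ) (d : Fin (s ^ 2) → ℕ) (v ε : Fin (2 ^ s) → Fin (2 ^ s) → Fin (s ^ 2) → ℤ) (n : ℕ)
      (θ : Fin (n + 1) → ℤ) (p : Fin (n + 1) → Equiv.Perm (Fin (2 ^ s)) × (Fin (2 ^ s) → Fin (s ^ 2))),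
      (∀ i j l, (ε i j l).natAbs ≤ 1) → StrictMono θ → (∀ k, IsDominant d v ε (θ k) (p k)) →
      (∀ k : Fin n, termSign ε (p k.castSucc) * termSign ε (p k.succ) < 0) →
      (univ.filter fun k : Fin n => (p k.castSucc).1 ≠ (p k.succ).1).card ≤ 2 ^ (C * s ^ 2) := by
  classical
  obtain ⟨C, hC⟩ := permSteps_of_tropicalB h
  refine ⟨2 * C, fun s d v ε n θ p hε hθ hdom halt => ?_⟩
  have h1 := hC (2 ^ s) (s ^ 2) d v ε n θ p hε hθ hdom halt
  rw [log_two_pow] at h1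
  have h2 : C * (s ^ 2 + s ^ 2) = 2 * C * s ^ 2 := by ring
  rw [h2] at h1
  exact h1

/-- **`TropicalB` ⟺ the permutation-step budget on the diagonal.**  The crux is the statement that sign-alternating
dominant chains of `s²`-slope-class dominance designs on `2^s` nodes change their permutation at most `2^(O(s²))` times
(slope counting allows `2^(Θ(s³))`; class flips contribute `< 2^(3s + 2 log₂ s + 2)`). -/
theorem tropicalB_iff_permSteps_diagonal :
    TropicalB ↔ ∃ C : ℕ, ∀ (s : ℕ) (d : Fin (s ^ 2) → ℕ) (v ε : Fin (2 ^ s) → Fin (2 ^ s) → Fin (s ^ 2) → ℤ) (n : ℕ)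
      (θ : Fin (n + 1) → ℤ) (p : Fin (n + 1) → Equiv.Perm (Fin (2 ^ s)) × (Fin (2 ^ s) → Fin (s ^ 2))),
      (∀ i j l, (ε i j l).natAbs ≤ 1) → StrictMono θ → (∀ k, IsDominant d v ε (θ k) (p k)) →
      (∀ k : Fin n, termSign ε (p k.castSucc) * termSign ε (p k.succ) < 0) →
      (univ.filter fun k : Fin n => (p k.castSucc).1 ≠ (p k.succ).1).card ≤ 2 ^ (C * s ^ 2) :=
  ⟨permSteps_diagonal_of_tropicalB, tropicalB_of_permSteps_diagonal⟩

end Summit.ValiantsHypothesis.ValiantsHypothesis.Theorems.KPlusLogSqLaw
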